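import Summits.BirchSwinnertonDyer.BirchSwinnertonDyer.Theorems.AlignedTransportAtTwoMainConjectureTransportAlignedAtTwoDeltaPosCongruenceLevel
import Literature.NumberTheory.EllipticCurves.ModularJacobianGaloisDataWithForms
import HarnessLib

/-!
# Crux C1 `MainConjectureTransportAlignedAtTwo` (stmt-BirchSwinnertonDyer-22296), line `birth`, plan «deltapos-galois» step (G4), INSTANCE: the `λ`-law of
# `stub_lamLawDeltaPos` for ALL conductors from the carrier WITH FORMS `ModularJacobianGaloisDataWithForms` (T1⁺, Literature, p669569), the odd Manin
# constants (T4) and three PRINT facts — and the stub's statement VERBATIM modulo {PRINT³, T1⁺, T4} (width seat att-p3 g14; `--supports 22296`)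

THEOREMS ONLY (no `def`, no named fact, no `sorry`). CONDITIONAL (hypotheses): `heckeSelfDual_torsionBy_J0`, `buzzard2000_multiplicityOne_gamma0`,
`realPeriodRat_eq_unit_mul_plusPeriod_two` (PRINT); `nonempty_modularJacobianGaloisDataWithForms` (T1⁺, the named fact of
`Literature/NumberTheory/EllipticCurves/ModularJacobianGaloisDataWithForms.lean`: `J₀(L)` and the Jacobi maps of rational lattice-compatible forms are defined over `ℚ`,
DDT §1.5/§1.7 + `q`-expansion principle); and parametrisation data at the conductor level with ODD Manin constant (T4 — Abbes–Ullmo Thm A for the optimal curve,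
odd-isogeny transport in the `E[2]`-irreducible class, Kriz–Li 2019 §5; taken as data `Dᵢ` + `Odd Dᵢ.c`, or as the hypothesis `hT4` below).
BSD is not proved by this; C1 is not closed by this; `stub_lamLawDeltaPos` is NOT discharged unconditionally — `lamLawDeltaPos_of_print` IS its statement
modulo the five named inputs, which is what a v25 skeleton can register in its place.

* `lamLawDeltaPos_of_forms` — instance of `…DeltaPosCongruenceLevel.lamLawDeltaPos_of_abstractForms` (this seat, p670177): `Φᵢ := Dᵢ.jacobiMapForm N' (D_S•gᵢ)`,
  `gal := J'.galAct`, `J' : ModularJacobianGaloisDataWithForms N' ι`, `N' = N₁N₂·∏ℓ²`, `gᵢ` the `S`-depleted eigenforms (`…StarLevel.exists_depleted_eigenform_of_dvd`).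
* **`lamLawDeltaPos_of_print`** — the body of `stub_lamLawDeltaPos` VERBATIM (all its binders, the idle ones included) from `hSD`, `hBz`, `hΩu`, `hJ`, `hT4`.

References: Greenberg–Vatsal 2000 Thm. (1.4); Darmon–Diamond–Taylor 1995 §1.5–§1.7, Lemma 1.38; Buzzard 2000 Prop. 2.4; Atkin–Lehner 1970 §3; Abbes–Ullmo 1996
Thm A; Kriz–Li 2019 §5; Matsuno 2008 Thm. 4.2.
-/

noncomputable section

-- justification: the `Summit.BirchSwinnertonDyer.BirchSwinnertonDyer.…` path repeats a component (route-file convention)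
set_option linter.dupNamespace false
set_option autoImplicit false

open scoped MatrixGroups ModularForm NumberField Classical
open CongruenceSubgroup Complex WeierstrassCurve IsDedekindDomain Polynomial Module
open Literature.NumberTheory.EllipticCurves Literature.NumberTheory.EllipticCurves.ModularForms
open Literature.NumberTheory.EllipticCurves.Greenberg1999 Literature.NumberTheory.EllipticCurves.GreenbergVatsal2000
open Summit.BirchSwinnertonDyer.Rank1Residual.F1Sign2 Summit.BirchSwinnertonDyer.Rank1Residual.X1.MuLambda
open Summit.BirchSwinnertonDyer.BirchSwinnertonDyer.Theorems.AlignedTransportAtTwoClosure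
open Summit.BirchSwinnertonDyer.BirchSwinnertonDyer.Theorems.ThetaLayerLambdaCongruenceAtTwo
open Summit.BirchSwinnertonDyer.BirchSwinnertonDyer.Theorems.AlignedTransportAtTwoDeltaPosFunctionalDepleted
open Summit.BirchSwinnertonDyer.BirchSwinnertonDyer.Theorems.AlignedTransportAtTwoDeltaPosCongruenceLevel

namespace Summit.BirchSwinnertonDyer.BirchSwinnertonDyer.Theorems.AlignedTransportAtTwoDeltaPosCongruenceForms

/-- `aₙ(c • g) = c·aₙ(g)` on `S₂(Γ₀(N))` (Mathlib `ModularForm.qExpansion_smul` at the cusp `∞` of strict width `1`). [folklore] -/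
theorem cuspCoeff_smul_gamma0 {N : ℕ} (c : ℂ) (g : CuspForm (Gamma0 N) 2) (n : ℕ) : cuspCoeff (c • g) n = c * cuspCoeff g n := by
  have hΓ : (1 : ℝ) ∈ (Gamma0 N : Subgroup (GL (Fin 2) ℝ)).strictPeriods := by
    have h := (Gamma0 N : Subgroup (GL (Fin 2) ℝ)).strictWidthInfty_mem_strictPeriods
    rwa [CongruenceSubgroup.strictWidthInfty_Gamma0] at h
  unfold cuspCoeff
  have hcoe : (⇑(c • g) : UpperHalfPlane → ℂ) = c • ⇑g := rfl
  rw [hcoe, ModularForm.qExpansion_smul one_pos hΓ c g]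
  simp

/-- **(G4) INSTANCE: the `λ`-law of the `Δ > 0` cell for ALL conductors from the carrier with forms.** Binders of `stub_lamLawDeltaPos` (the used ones) + PRINT
(`hSD hBz hΩu`) + T4 (`D₁ D₂` at the conductor levels, odd `cᵢ`) + T1⁺ (`J' : ModularJacobianGaloisDataWithForms N' ι` at `N' = N₁N₂·∏_{ℓ∣N₁N₂}ℓ²`) ⟹ the
conclusion of `stub_lamLawDeltaPos` verbatim. [cite: GreenbergVatsal2000, Thm. (1.4) and §3] [cite: DarmonDiamondTaylor1995, §1.5 and §1.7]
[cite: Buzzard2000LevelLoweringModTwo, Prop. 2.4] [cite: AtkinLehner1970, §3] -/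
theorem lamLawDeltaPos_of_forms
    (hSD : heckeSelfDual_torsionBy_J0) (hBz : buzzard2000_multiplicityOne_gamma0) (hΩu : realPeriodRat_eq_unit_mul_plusPeriod_two)
    (W₁ : WeierstrassCurve ℚ) [W₁.IsElliptic] [W₁.IsGloballyMinimal]
    (W₂ : WeierstrassCurve ℚ) [W₂.IsElliptic] [W₂.IsGloballyMinimal]
    (hord₁ : IsOrdinaryAt W₁ 2) (hord₂ : IsOrdinaryAt W₂ 2)
    (ht₁ : ∀ x : ℚ, ¬ HasRationalTwoTorsionX W₁ x) (ht₂ : ∀ x : ℚ, ¬ HasRationalTwoTorsionX W₂ x)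
    (hsq₂ : ¬ IsSquare W₂.Δ) (hK : ¬ OnKilfordStratumAtTwo W₁) (hΔ : 0 < W₁.Δ)
    {F : Type} [Field F] [NumberField F] (hF : finrank ℚ F = 3)
    {e₁ e₂ : F} (he₁ : aeval e₁ (twoDivisionUCubic W₁) = 0) (he₂ : aeval e₂ (twoDivisionUCubic W₂) = 0)
    (hal : AlignedAtInfinity F (twoDivisionUCubic W₁) (twoDivisionUCubic W₂) e₁ e₂)
    [NeZero (W₁.conductorNorm ℤ)] [NeZero (W₂.conductorNorm ℤ)]
    {f₁ : CuspForm (Gamma0 (W₁.conductorNorm ℤ)) 2} (hf₁ : IsNewformOf W₁ f₁)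
    {f₂ : CuspForm (Gamma0 (W₂.conductorNorm ℤ)) 2} (hf₂ : IsNewformOf W₂ f₂)
    {G₁ G₂ : IwasawaAlgebra 2} (hG₁ : IsEvenBranchLiftAtTwo W₁ f₁ G₁) (hG₂ : IsEvenBranchLiftAtTwo W₂ f₂ G₂)
    (D₁ : ModularParametrizationData W₁ (W₁.conductorNorm ℤ)) (D₂ : ModularParametrizationData W₂ (W₂.conductorNorm ℤ))
    (hc₁ : Odd D₁.c) (hc₂ : Odd D₂.c)
    (ι : AlgebraicClosure ℚ →+* ℂ) (N' : ℕ) [NeZero N']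
    (hN' : N' = W₁.conductorNorm ℤ * W₂.conductorNorm ℤ *
      ∏ ℓ ∈ (W₁.conductorNorm ℤ * W₂.conductorNorm ℤ).primeFactors.erase 2, ℓ ^ 2)
    (J' : ModularJacobianGaloisDataWithForms N' ι) :
    lam G₁ + ∑ ℓ ∈ (W₁.conductorNorm ℤ * W₂.conductorNorm ℤ).primeFactors.erase 2, lambdaCorrectionAtTwo W₁ ℓ =
      lam G₂ + ∑ ℓ ∈ (W₁.conductorNorm ℤ * W₂.conductorNorm ℤ).primeFactors.erase 2, lambdaCorrectionAtTwo W₂ ℓ := by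
  -- §0 the depleted level and its prime support
  have hN₁0 : W₁.conductorNorm ℤ ≠ 0 := NeZero.ne _
  have hN₂0 : W₂.conductorNorm ℤ ≠ 0 := NeZero.ne _
  have h2N₁ : ¬ 2 ∣ W₁.conductorNorm ℤ := not_dvd_level_of_isNewformOf hf₁ hord₁.1
  have h2N₂ : ¬ 2 ∣ W₂.conductorNorm ℤ := not_dvd_level_of_isNewformOf hf₂ hord₂.1
  set M : ℕ := W₁.conductorNorm ℤ * W₂.conductorNorm ℤ with hM
  have hM0 : M ≠ 0 := mul_ne_zero hN₁0 hN₂0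
  have h2M : ¬ 2 ∣ M := fun h ↦ ((Nat.Prime.dvd_mul Nat.prime_two).mp h).elim h2N₁ h2N₂
  set SS : Finset ℕ := M.primeFactors.erase 2 with hSS
  have hSSp : ∀ ℓ ∈ SS, ℓ.Prime := fun ℓ hℓ ↦ Nat.prime_of_mem_primeFactors (Finset.mem_of_mem_erase hℓ)
  have hSSdvd : ∀ ℓ ∈ SS, ℓ ∣ M := fun ℓ hℓ ↦ Nat.dvd_of_mem_primeFactors (Finset.mem_of_mem_erase hℓ)
  have hNL₁ : W₁.conductorNorm ℤ * ∏ ℓ ∈ SS, ℓ ^ 2 ∣ N' := ⟨W₂.conductorNorm ℤ, by rw [hN', hM]; ring⟩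
  have hNL₂ : W₂.conductorNorm ℤ * ∏ ℓ ∈ SS, ℓ ^ 2 ∣ N' := ⟨W₁.conductorNorm ℤ, by rw [hN', hM]; ring⟩
  have hLS : ∀ p : ℕ, p.Prime → p ∣ N' → p ∈ SS := by
    intro p hp hpN
    rw [hN'] at hpN
    rcases (Nat.Prime.dvd_mul hp).mp hpN with h | h
    · refine Finset.mem_erase.mpr ⟨?_, Nat.mem_primeFactors.mpr ⟨hp, h, hM0⟩⟩
      rintro rfl; exact h2M h
    · obtain ⟨ℓ, hℓ, hℓp⟩ := (hp.prime.dvd_finsetProd_iff _).mp h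
      rwa [(Nat.prime_dvd_prime_iff_eq hp (hSSp ℓ hℓ)).mp (hp.dvd_of_dvd_pow hℓp)]
  -- §1 the depleted eigenforms at level `N'`
  have hint₁ : ∀ n : ℕ, ∃ z : ℤ, cuspCoeff f₁ n = z := fun n ↦ ⟨W₁.LFunction n, hf₁.2 n⟩
  have hint₂ : ∀ n : ℕ, ∃ z : ℤ, cuspCoeff f₂ n = z := fun n ↦ ⟨W₂.LFunction n, hf₂.2 n⟩
  have hTf₁ : ∀ (p : ℕ) (hp : p.Prime),
      (haveI : NeZero p := ⟨hp.ne_zero⟩; heckeT (Gamma0 (W₁.conductorNorm ℤ)) 2 p f₁) = cuspCoeff f₁ p • f₁ :=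
    fun p hp ↦ by haveI : NeZero p := ⟨hp.ne_zero⟩; exact hf₁.1.heckeT_eq_coeff_smul hp
  have hTf₂ : ∀ (p : ℕ) (hp : p.Prime),
      (haveI : NeZero p := ⟨hp.ne_zero⟩; heckeT (Gamma0 (W₂.conductorNorm ℤ)) 2 p f₂) = cuspCoeff f₂ p • f₂ :=
    fun p hp ↦ by haveI : NeZero p := ⟨hp.ne_zero⟩; exact hf₂.1.heckeT_eq_coeff_smul hp
  obtain ⟨g₁, hg₁, -, -, -, -, -, -⟩ := exists_depleted_eigenform_of_dvd f₁ hint₁ hf₁.1.2.2 hTf₁ SS hSSp N' hNL₁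
    (fun p hp hpN ↦ Or.inr (hLS p hp hpN))
  obtain ⟨g₂, hg₂, -, -, -, -, -, -⟩ := exists_depleted_eigenform_of_dvd f₂ hint₂ hf₂.1.2.2 hTf₂ SS hSSp N' hNL₂
    (fun p hp hpN ↦ Or.inr (hLS p hp hpN))
  have hfD₁ : D₁.f = f₁ := eq_of_forall_cuspCoeff_eq_gamma0 fun n ↦ by rw [D₁.isNewformOf.2 n, hf₁.2 n]
  have hfD₂ : D₂.f = f₂ := eq_of_forall_cuspCoeff_eq_gamma0 fun n ↦ by rw [D₂.isNewformOf.2 n, hf₂.2 n]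
  have hg₁D : ∀ n : ℕ, cuspCoeff g₁ n = if ∃ ℓ ∈ SS, ℓ ∣ n then 0 else cuspCoeff D₁.f n := fun n ↦ by rw [hg₁ n, hfD₁]
  have hg₂D : ∀ n : ℕ, cuspCoeff g₂ n = if ∃ ℓ ∈ SS, ℓ ∣ n then 0 else cuspCoeff D₂.f n := fun n ↦ by rw [hg₂ n, hfD₂]
  -- §2 the forms `D_S • gᵢ`: rational `q`-expansions and lattice compatibility
  set DS : ℂ := ((∏ ℓ ∈ SS, ℓ ^ 2 : ℕ) : ℂ) with hDS
  have hrat : ∀ {N₀ : ℕ} [NeZero N₀] {f : CuspForm (Gamma0 N₀) 2} {W : WeierstrassCurve ℚ} (_ : IsNewformOf W f)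
      (g : CuspForm (Gamma0 N') 2)
      (_ : ∀ n : ℕ, cuspCoeff g n = if ∃ ℓ ∈ SS, ℓ ∣ n then 0 else cuspCoeff f n) (n : ℕ),
      ∃ q : ℚ, cuspCoeff (DS • g) n = (q : ℂ) := by
    intro N₀ _ f W hf g hg n
    rw [cuspCoeff_smul_gamma0, hg n]
    split_ifs
    · exact ⟨0, by simp⟩
    · refine ⟨(∏ ℓ ∈ SS, ℓ ^ 2 : ℕ) * W.LFunction n, ?_⟩
      rw [hf.2 n, hDS]; push_cast; ring
  have hlat₁ : ∀ φ ∈ periodHomology N', (D₁.c : ℂ) * φ (DS • g₁) ∈ D₁.L.lattice := fun φ hφ ↦ by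
    rw [map_smul, smul_eq_mul]
    exact maninConstant_mul_prodSq_mul_eval_depleted_mem D₁ SS hSSp N' hNL₁ g₁ hg₁D hφ
  have hlat₂ : ∀ φ ∈ periodHomology N', (D₂.c : ℂ) * φ (DS • g₂) ∈ D₂.L.lattice := fun φ hφ ↦ by
    rw [map_smul, smul_eq_mul]
    exact maninConstant_mul_prodSq_mul_eval_depleted_mem D₂ SS hSSp N' hNL₂ g₂ hg₂D hφ
  -- §3 the carrier's Jacobi maps and Galois action
  refine lamLawDeltaPos_of_abstractForms hSD hBz hΩu W₁ W₂ hord₁ hord₂ ht₁ ht₂ hsq₂ hK hΔ hF he₁ he₂ hal hf₁ hf₂ hG₁ hG₂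
    D₁ D₂ hc₁ hc₂ SS hSS N' hN' g₁ g₂ hg₁ hg₂ ι
    (D₁.jacobiMapForm N' (DS • g₁) hlat₁) (D₂.jacobiMapForm N' (DS • g₂) hlat₂)
    (fun y ↦ by rw [ModularParametrizationData.jacobiMapForm_mk, map_smul, smul_eq_mul])
    (fun y ↦ by rw [ModularParametrizationData.jacobiMapForm_mk, map_smul, smul_eq_mul])
    (fun σ ↦ (J'.galAct σ).toLinearMap.toAddMonoidHom) (fun σ y P h ↦ ?_) (fun σ y P h ↦ ?_)
  · exact J'.jacobiMapForm_galAct W₁ _ D₁ (DS • g₁) (hrat hf₁ g₁ hg₁) hlat₁ σ y P h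
  · exact J'.jacobiMapForm_galAct W₂ _ D₂ (DS • g₂) (hrat hf₂ g₂ hg₂) hlat₂ σ y P h

/-- **`stub_lamLawDeltaPos` MODULO {PRINT³, T1⁺, T4}: its statement VERBATIM** from `heckeSelfDual_torsionBy_J0`, `buzzard2000_multiplicityOne_gamma0`,
`realPeriodRat_eq_unit_mul_plusPeriod_two` (PRINT), `nonempty_modularJacobianGaloisDataWithForms` (T1⁺) and the odd-Manin-constant supply `hT4` (for every
globally minimal curve, good ordinary at `2`, without rational `2`-torsion abscissa: a parametrisation datum at the conductor level with odd Manin constant — Abbes–Ullmo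
+ odd-isogeny transport; a hypothesis here, to be typed). [cite: GreenbergVatsal2000, Thm. (1.4) and §3] [cite: DarmonDiamondTaylor1995, §1.5 and §1.7]
[cite: AbbesUllmo1996, Thm. A] [cite: Buzzard2000LevelLoweringModTwo, Prop. 2.4] -/
theorem lamLawDeltaPos_of_print
    (hSD : heckeSelfDual_torsionBy_J0) (hBz : buzzard2000_multiplicityOne_gamma0) (hΩu : realPeriodRat_eq_unit_mul_plusPeriod_two)
    (hJ : nonempty_modularJacobianGaloisDataWithForms)
    (hT4 : ∀ (W : WeierstrassCurve ℚ) [W.IsElliptic] [W.IsGloballyMinimal] [NeZero (W.conductorNorm ℤ)],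
      IsOrdinaryAt W 2 → (∀ x : ℚ, ¬ HasRationalTwoTorsionX W x) →
        ∃ D : ModularParametrizationData W (W.conductorNorm ℤ), Odd D.c) :
    ∀ (W₁ : WeierstrassCurve ℚ) [W₁.IsElliptic] [W₁.IsGloballyMinimal]
      (W₂ : WeierstrassCurve ℚ) [W₂.IsElliptic] [W₂.IsGloballyMinimal],
      IsOrdinaryAt W₁ 2 → IsOrdinaryAt W₂ 2 →
      (∀ x : ℚ, ¬ HasRationalTwoTorsionX W₁ x) → (∀ x : ℚ, ¬ HasRationalTwoTorsionX W₂ x) →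
      ¬ IsSquare W₁.Δ → ¬ IsSquare W₂.Δ →
      (¬ ∃ (d : ℚ) (c : WeierstrassCurve.VariableChange ℚ), c • W₁.quadraticTwist d = W₂) →
      ¬ OnKilfordStratumAtTwo W₁ → 0 < W₁.Δ →
      ∀ (F : Type) [Field F] [NumberField F], Module.finrank ℚ F = 3 →
      ∀ e₁ e₂ : F, aeval e₁ (twoDivisionUCubic W₁) = 0 → aeval e₂ (twoDivisionUCubic W₂) = 0 →
      AlignedAtTwo F e₁ e₂ → AlignedAtInfinity F (twoDivisionUCubic W₁) (twoDivisionUCubic W₂) e₁ e₂ →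
      ∀ [NeZero (W₁.conductorNorm ℤ)] [NeZero (W₂.conductorNorm ℤ)]
        (f₁ : CuspForm (Gamma0 (W₁.conductorNorm ℤ)) 2), IsNewformOf W₁ f₁ →
      ∀ (f₂ : CuspForm (Gamma0 (W₂.conductorNorm ℤ)) 2), IsNewformOf W₂ f₂ →
      ∀ G₁ G₂ : IwasawaAlgebra 2, IsEvenBranchLiftAtTwo W₁ f₁ G₁ → IsEvenBranchLiftAtTwo W₂ f₂ G₂ →
        lam G₁ + ∑ ℓ ∈ (W₁.conductorNorm ℤ * W₂.conductorNorm ℤ).primeFactors.erase 2, lambdaCorrectionAtTwo W₁ ℓ =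
          lam G₂ + ∑ ℓ ∈ (W₁.conductorNorm ℤ * W₂.conductorNorm ℤ).primeFactors.erase 2, lambdaCorrectionAtTwo W₂ ℓ := by
  intro W₁ _ _ W₂ _ _ hord₁ hord₂ ht₁ ht₂ _ hsq₂ _ hK hΔ F _ _ hF e₁ e₂ he₁ he₂ _ hal _ _ f₁ hf₁ f₂ hf₂ G₁ G₂ hG₁ hG₂
  obtain ⟨D₁, hc₁⟩ := hT4 W₁ hord₁ ht₁
  obtain ⟨D₂, hc₂⟩ := hT4 W₂ hord₂ ht₂
  -- an embedding `ℚ̄ → ℂ` and the carrier at the depleted level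
  let ι : AlgebraicClosure ℚ →+* ℂ :=
    (@IsAlgClosed.lift ℂ _ _ ℚ _ _ (AlgebraicClosure ℚ) _ _ (AlgebraicClosure.instAlgebra ℚ) _ _ _
      (AlgebraicClosure.isAlgebraic ℚ)).toRingHom
  set N' : ℕ := W₁.conductorNorm ℤ * W₂.conductorNorm ℤ *
    ∏ ℓ ∈ (W₁.conductorNorm ℤ * W₂.conductorNorm ℤ).primeFactors.erase 2, ℓ ^ 2 with hN'
  haveI : NeZero N' := ⟨by
    rw [hN']
    refine mul_ne_zero (mul_ne_zero (NeZero.ne _) (NeZero.ne _)) (Finset.prod_ne_zero_iff.mpr fun ℓ hℓ ↦ pow_ne_zero _ ?_)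
    exact (Nat.prime_of_mem_primeFactors (Finset.mem_of_mem_erase hℓ)).ne_zero⟩
  obtain ⟨J'⟩ := hJ N' ι
  exact lamLawDeltaPos_of_forms hSD hBz hΩu W₁ W₂ hord₁ hord₂ ht₁ ht₂ hsq₂ hK hΔ hF he₁ he₂ hal hf₁ hf₂ hG₁ hG₂ D₁ D₂ hc₁ hc₂
    ι N' hN' J'

end Summit.BirchSwinnertonDyer.BirchSwinnertonDyer.Theorems.AlignedTransportAtTwoDeltaPosCongruenceForms

end
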